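import Summits.CriticalPhenomena.Ising3DConformalLimit.Theses.HyperoctahedralRP
import Literature.Barriers.CriticalPhenomena.ScaleCovarianceNotMoebius
import Literature.Probability.LatticeModels.CriticalWickDichotomy
import Literature.Probability.LatticeModels.CriticalScalingDimension
import Summits.CriticalPhenomena.Ising3DConformalLimit.Theorems.MoebiusLimitOfTwoPointLaw.Negative.TwoPointConvergence

/-!
# `InversionUpgradeNormalised` (item stmt-CriticalPhenomena-1982): automatic orders and pinned data

Negative knowledge about the crux
`Summit.CriticalPhenomena.Ising3DConformalLimit.Theses.HyperoctahedralRP.InversionUpgradeNormalised`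
(standing crux disprover, cycles 1–2, D-0016):

  ∀ ρ Δ S, (H1) ρ > 0 on (0,1] → (H2) HasPointwiseScalingLimit (criticalCorr 3) ρ S →
    (H3) S = 0 off NonCoincident → (H4) IsNondegenerateTwoPoint S → (H5) IsEuclideanInvariant S →
    (H6) IsScaleCovariant Δ S → IsInversionCovariant Δ S.

* ORDERS. The order-`n` clause of the conclusion is AUTOMATIC for `n = 0` (empty product), for all
  ODD `n` (`S n ≡ 0`: `m*(β_c) = 0` on `ℤ³`, tree `HasPointwiseScalingLimit.eq_zero_of_odd`, plus
  (H3)), and for `n = 2` MODEL-BLIND from (H3)+(H5)+(H6) (`two_point_eq`). Hence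
  `crux_iff_evenFromFour`: the crux is exactly the conformal covariance of `S₄, S₆, …` of the
  pinned limit.
* PINNED DATA. `S 0 ≡ 1` (`limit_zero_eq_one`); `Δ ∈ [1/2, 1]` (`delta_mem_Icc_of_hyp`, tree
  `scalingDimension_mem_Icc_holds`), so the crux at any `Δ` off the window is vacuous
  (`crux_at_of_not_mem_window`).

Theorem-only file (no new definitions). Companion: `Negative/LoadBearingHypotheses.lean`.
-/

noncomputable section

namespace Summit.CriticalPhenomena.Ising3DConformalLimit.InversionUpgradeNormalisedNegative

open Literature.Probability.LatticeModels Literature.Barriers.CriticalPhenomena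
open Filter Set Function EuclideanGeometry
open scoped Topology

/-! ## Orders `0`, odd, `2` of the conclusion are automatic -/

/-- `n = 0`: the inversion identity holds for every family (empty product, `Fin 0` configurations
are all equal). [folklore] -/
theorem invIdentity_zero (Δ : ℝ) (S : CorrFamily 3) (x : Fin 0 → EuclideanSpace ℝ (Fin 3)) :
    S 0 (fun i => inversion 0 1 (x i)) = (∏ i, ‖x i‖ ^ (2 * Δ)) * S 0 x := by
  have hx : (fun i => inversion 0 1 (x i)) = x := funext fun i => i.elim0
  simp [hx]

/-- Inverting a configuration preserves (non-)injectivity (`inversion 0 1` is injective). [folklore] -/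
theorem injective_inversion_comp_iff {n : ℕ} {x : Fin n → EuclideanSpace ℝ (Fin 3)} :
    Function.Injective (fun i => inversion (0 : EuclideanSpace ℝ (Fin 3)) 1 (x i)) ↔ Function.Injective x := by
  constructor
  · intro h i j hij
    exact h (by simp [hij])
  · intro h i j hij
    exact h (inversion_injective (0 : EuclideanSpace ℝ (Fin 3)) one_ne_zero hij)

/-- ODD ORDERS vanish identically for normalised limits of `criticalCorr 3`: on `NonCoincident` by
`m*(β_c) = 0` (tree `HasPointwiseScalingLimit.eq_zero_of_odd`), off it by (H3).
[cite: AizenmanDuminilCopinSidoraviciusCMP2015, Thm. 1.2] -/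
theorem limit_odd_eq_zero {ρ : ℝ → ℝ} {S : CorrFamily 3}
    (hlim : HasPointwiseScalingLimit (criticalCorr 3) ρ S)
    (hnorm : ∀ n z, z ∉ NonCoincident 3 n → S n z = 0) {n : ℕ} (hn : Odd n)
    (x : Fin n → EuclideanSpace ℝ (Fin 3)) : S n x = 0 := by
  by_cases hx : x ∈ NonCoincident 3 n
  · exact hlim.eq_zero_of_odd (by norm_num) hn hx
  · exact hnorm n x hx

/-- ODD ORDERS of the conclusion are automatic under (H2)+(H3). [folklore] -/
theorem invIdentity_odd {ρ : ℝ → ℝ} (Δ : ℝ) {S : CorrFamily 3}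
    (hlim : HasPointwiseScalingLimit (criticalCorr 3) ρ S)
    (hnorm : ∀ n z, z ∉ NonCoincident 3 n → S n z = 0) {n : ℕ} (hn : Odd n)
    (x : Fin n → EuclideanSpace ℝ (Fin 3)) :
    S n (fun i => inversion 0 1 (x i)) = (∏ i, ‖x i‖ ^ (2 * Δ)) * S n x := by
  rw [limit_odd_eq_zero hlim hnorm hn, limit_odd_eq_zero hlim hnorm hn, mul_zero]

/-- Two-point structure of a Euclidean-invariant, scale-covariant family (MODEL-BLIND): for `a ≠ b`,
`S₂(a,b) = ‖a - b‖^{-2Δ} · S₂(0,e₀)` (translate, reflect with `Submodule.reflection_sub`, scale).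
[cite: FrancescoMathieuSenechal1997, §4.3.1] -/
theorem two_point_eq {Δ : ℝ} {S : CorrFamily 3} (heuc : IsEuclideanInvariant S)
    (hsc : IsScaleCovariant Δ S) {a b : EuclideanSpace ℝ (Fin 3)} (hab : a ≠ b) :
    S 2 ![a, b] = ‖a - b‖ ^ (-(2 * Δ)) * S 2 ![0, EuclideanSpace.single 0 1] := by
  set e : EuclideanSpace ℝ (Fin 3) := EuclideanSpace.single 0 1 with he
  have hne : ‖e‖ = 1 := by simp [he]
  set r : ℝ := ‖b - a‖ with hr
  have hr0 : 0 < r := norm_pos_iff.mpr (sub_ne_zero.mpr (Ne.symm hab))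
  have h1 : S 2 ![a, b] = S 2 ![0, b - a] := by
    have h := heuc.1 2 (-a) ![a, b]
    rw [← h]
    congr 1
    funext i
    fin_cases i <;> simp [sub_eq_add_neg]
  have hnorm_eq : ‖b - a‖ = ‖r • e‖ := by
    rw [norm_smul, hne, mul_one, Real.norm_eq_abs, abs_of_pos hr0]
  have hRv : Submodule.reflection (ℝ ∙ ((b - a) - r • e))ᗮ (b - a) = r • e :=
    Submodule.reflection_sub hnorm_eq
  have h2 : S 2 ![0, b - a] = S 2 ![0, r • e] := by
    have h := heuc.2 2 (Submodule.reflection (ℝ ∙ ((b - a) - r • e))ᗮ) ![0, b - a]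
    rw [← h]
    congr 1
    funext i
    fin_cases i <;> simp [hRv]
  have h3 : S 2 ![0, r • e] = r ^ (-(2 * Δ)) * S 2 ![0, e] := by
    have h := hsc 2 r hr0 ![0, e]
    have hfun : (fun i => r • (![0, e] : Fin 2 → EuclideanSpace ℝ (Fin 3)) i) = ![0, r • e] := by
      funext i
      fin_cases i <;> simp
    have hexp : (-((2 : ℕ) : ℝ) * Δ) = -(2 * Δ) := by push_cast; ring
    rw [hfun, hexp] at h
    exact h
  rw [h1, h2, h3, hr, norm_sub_rev]

/-- MODEL-BLIND two-point inversion law for distinct non-zero points. [cite: FrancescoMathieuSenechal1997, §4.1 eq. (4.15)] -/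
theorem two_point_inversion {Δ : ℝ} {S : CorrFamily 3} (heuc : IsEuclideanInvariant S)
    (hsc : IsScaleCovariant Δ S) {p q : EuclideanSpace ℝ (Fin 3)} (hpq : p ≠ q) (hp : p ≠ 0)
    (hq : q ≠ 0) :
    S 2 ![inversion 0 1 p, inversion 0 1 q] = ‖p‖ ^ (2 * Δ) * ‖q‖ ^ (2 * Δ) * S 2 ![p, q] := by
  have hinj := inversion_injective (0 : EuclideanSpace ℝ (Fin 3)) one_ne_zero
  have hpq' : inversion 0 1 p ≠ inversion 0 1 q := fun h => hpq (hinj h)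
  rw [two_point_eq heuc hsc hpq', two_point_eq heuc hsc hpq]
  have key := ScaleNotMoebius.twoPt_inversion Δ hp hq
  simp only [ScaleNotMoebius.twoPt] at key
  rw [key]
  ring

/-- `n = 2` of the conclusion is automatic and MODEL-BLIND from (H3)+(H5)+(H6). [folklore] -/
theorem invIdentity_two {Δ : ℝ} {S : CorrFamily 3}
    (hnorm : ∀ n z, z ∉ NonCoincident 3 n → S n z = 0)
    (heuc : IsEuclideanInvariant S) (hsc : IsScaleCovariant Δ S)
    (x : Fin 2 → EuclideanSpace ℝ (Fin 3)) (hx : ∀ i, x i ≠ 0) :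
    S 2 (fun i => inversion 0 1 (x i)) = (∏ i, ‖x i‖ ^ (2 * Δ)) * S 2 x := by
  by_cases hinj : Function.Injective x
  · have h01 : x 0 ≠ x 1 := fun h => absurd (hinj h) (by decide)
    have hx2 : x = ![x 0, x 1] := by funext i; fin_cases i <;> rfl
    have hinv2 : (fun i => inversion (0 : EuclideanSpace ℝ (Fin 3)) 1 (x i)) = ![inversion 0 1 (x 0), inversion 0 1 (x 1)] := by
      funext i; fin_cases i <;> rfl
    rw [hinv2, Fin.prod_univ_two]
    conv_rhs => rw [hx2]
    exact two_point_inversion heuc hsc h01 (hx 0) (hx 1)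
  · have h1 : S 2 x = 0 := hnorm 2 x hinj
    have h2 : S 2 (fun i => inversion 0 1 (x i)) = 0 :=
      hnorm 2 _ (mt injective_inversion_comp_iff.1 hinj)
    rw [h1, h2, mul_zero]

/-- **REDUCTION.** The crux `InversionUpgradeNormalised` is equivalent to its EVEN orders `n ≥ 4`:
all other clauses of `IsInversionCovariant` are automatic under its hypotheses. So its whole
content is the conformal covariance of `S₄, S₆, …` of the pinned Ising₃ limit. [folklore] -/
theorem crux_iff_evenFromFour :
    Summit.CriticalPhenomena.Ising3DConformalLimit.Theses.HyperoctahedralRP.InversionUpgradeNormalised ↔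
      ∀ (ρ : ℝ → ℝ) (Δ : ℝ) (S : CorrFamily 3), (∀ δ ∈ Set.Ioc (0:ℝ) 1, 0 < ρ δ) →
        HasPointwiseScalingLimit (criticalCorr 3) ρ S → (∀ n z, z ∉ NonCoincident 3 n → S n z = 0) →
        IsNondegenerateTwoPoint S → IsEuclideanInvariant S → IsScaleCovariant Δ S →
        ∀ n, 4 ≤ n → Even n → ∀ x : Fin n → EuclideanSpace ℝ (Fin 3), (∀ i, x i ≠ 0) →
          S n (fun i => inversion 0 1 (x i)) = (∏ i, ‖x i‖ ^ (2 * Δ)) * S n x := by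
  constructor
  · intro h ρ Δ S h1 h2 h3 h4 h5 h6 n _ _ x hx
    exact h ρ Δ S h1 h2 h3 h4 h5 h6 n x hx
  · intro h ρ Δ S h1 h2 h3 h4 h5 h6 n x hx
    rcases Nat.even_or_odd n with hev | hodd
    · by_cases hn4 : 4 ≤ n
      · exact h ρ Δ S h1 h2 h3 h4 h5 h6 n hn4 hev x hx
      · interval_cases n
        · exact invIdentity_zero Δ S x
        · exact absurd hev (by decide)
        · exact invIdentity_two h3 h5 h6 x hx
        · exact absurd hev (by decide)
    · exact invIdentity_odd Δ h2 h3 hodd x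

/-! ## Pinned data: `S₀ = 1`, `Δ ∈ [1/2, 1]` -/

/-- ANY pointwise limit of the critical correlators has `S 0 ≡ 1` (the rescaled arity-`0`
correlator is the constant `1`, sibling lemma `MoebiusLimitOfTwoPointLaw.Negative.rescaledCorrelator_arity_zero`). [folklore] -/
theorem limit_zero_eq_one {ρ : ℝ → ℝ} {S : CorrFamily 3}
    (hlim : HasPointwiseScalingLimit (criticalCorr 3) ρ S) (x : Fin 0 → EuclideanSpace ℝ (Fin 3)) :
    S 0 x = 1 := by
  have hx : x ∈ NonCoincident 3 0 := by
    rw [mem_nonCoincident]; intro i; exact Fin.elim0 i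
  have h := (hlim 0).tendsto_at hx
  have h1 : Tendsto (fun δ => rescaledCorrelator (criticalCorr 3) ρ 0 δ x) (𝓝[>] (0:ℝ)) (𝓝 1) := by
    refine tendsto_const_nhds.congr fun δ => ?_
    exact (Summit.CriticalPhenomena.Ising3DConformalLimit.Theorems.MoebiusLimitOfTwoPointLaw.Negative.rescaledCorrelator_arity_zero
      ρ δ x).symm
  exact tendsto_nhds_unique h h1

/-- (H1)+(H2)+(H4)+(H6) pin `Δ` to the Ising window `[1/2, 1]` (infrared bound and Simon–Lieb,
tree `scalingDimension_mem_Icc_holds`). [cite: Simon1980, Thm. 1] -/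
theorem delta_mem_Icc_of_hyp {ρ : ℝ → ℝ} {Δ : ℝ} {S : CorrFamily 3}
    (hρ : ∀ δ ∈ Set.Ioc (0:ℝ) 1, 0 < ρ δ) (hlim : HasPointwiseScalingLimit (criticalCorr 3) ρ S)
    (hnd : IsNondegenerateTwoPoint S) (hsc : IsScaleCovariant Δ S) : Δ ∈ Set.Icc (1 / 2 : ℝ) 1 :=
  scalingDimension_mem_Icc_holds ρ Δ S hlim hsc hnd hρ

/-- The crux restricted to a scaling dimension OUTSIDE the window holds vacuously (so every decoy
or counterexample must live in `[1/2, 1]`). [folklore] -/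
theorem crux_at_of_not_mem_window {Δ : ℝ} (hΔ : Δ ∉ Set.Icc (1 / 2 : ℝ) 1) :
    ∀ (ρ : ℝ → ℝ) (S : CorrFamily 3), (∀ δ ∈ Set.Ioc (0:ℝ) 1, 0 < ρ δ) →
      HasPointwiseScalingLimit (criticalCorr 3) ρ S → (∀ n z, z ∉ NonCoincident 3 n → S n z = 0) →
      IsNondegenerateTwoPoint S → IsEuclideanInvariant S → IsScaleCovariant Δ S →
      IsInversionCovariant Δ S :=
  fun _ _ hρ hlim _ hnd _ hsc => absurd (delta_mem_Icc_of_hyp hρ hlim hnd hsc) hΔ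

end Summit.CriticalPhenomena.Ising3DConformalLimit.InversionUpgradeNormalisedNegative

end
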